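import Mathlib
import Summits.AtomisticToContinuum.Crystallization.Theorems.GappedShellCensusCleanLimitsHaveWindowsCleanChartCharts
import Summits.AtomisticToContinuum.Crystallization.Theorems.GappedShellCensusCleanLimitsHaveWindowsCleanChartGrowth
import Summits.AtomisticToContinuum.Crystallization.Theorems.PalmUnimodularRigidityShellsToBarlowChartDevelopCovering
import Summits.AtomisticToContinuum.Crystallization.Theorems.PalmUnimodularRigidityShellsToBarlowChartDeckTransitive
import Summits.AtomisticToContinuum.Crystallization.Theorems.PalmUnimodularRigidityShellsToBarlowChartPowerTranslation
import Summits.AtomisticToContinuum.Crystallization.Theorems.PalmUnimodularRigidityShellsToBarlowChartQuotientGrowth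
import Summits.AtomisticToContinuum.Crystallization.Theorems.GappedShellCensusCleanLimitsHaveWindowsCleanChartTGlobalG

/-!
# `CleanLimitsHaveWindows` (stmt-AtomisticToContinuum-15932), line `Sketch` — stub K1 `stub_cleanChart`:
# a clean torn-free set is the octet truss of a Barlow stacking

Registered stub of the lead skeleton (`Cruxes/CleanLimitsHaveWindows/Lines/Sketch.lean`, lead c2-0).  Proof:
rescale the clean set `Z` (scale `a`) by `c = 56/(51 a)` to `S` with bond length `b = 56/51`, so that
"bonded" (`dist ≤ 1.02 b`) is "distance in `(0, 28/25]`", the window of the crux `ShellsToBarlowChart`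
(route `PalmUnimodularRigidity`, PROVED in tree by the line `develop-the-model-growth-descent`); then run
that line's growth descent on `S`:

* the clean-chart hypothesis (`clean_charts`, file `…CleanChartCharts`: local chart `cleanChart_local` of
  `…CleanChartLocal` + the transfer lemma at matching radius `1/5`, `transfer_of_close` of
  `…CleanChartTransfer`) feeds the re-run transport development `….Clean.transportSystem_of_connected`
  (files `…CleanChartT*`, copies of `PalmUnimodularRigidityShellsToBarlowChartTransport*`), with
  connectivity from `clean_connected` (`…CleanChartGrowth`);
* `stub_developCovering` turns the transport system into a Hägg word and a bond covering
  `Ψ : barlowStacking 1 √(2/3) s → S`;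
* `Ψ` is injective by the growth descent of `barlowChart_of_stubs` (`stub_deckTransitive`,
  `stub_powerTranslation`, `stub_quotientGrowth` verbatim, cubic growth `clean_cubicGrowth` of
  `…CleanChartGrowth`), hence a bond isomorphism; scaling back gives the stub.
-/

noncomputable section

namespace Summit.AtomisticToContinuum.Crystallization.Theorems.CleanHull

open Literature.Geometry.DiscreteGeometry Literature.MathematicalPhysics.StatisticalMechanics
open Summit.AtomisticToContinuum.Crystallization.Theorems.PalmUnimodularRigidityShellsToBarlowChart
open Summit.AtomisticToContinuum.Crystallization.Theorems.ShellsToBarlowChartNegative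

/-! ## The growth descent on a clean set at scale `56/51` -/

/-- **Bond chart of a clean torn-free set at scale `56/51`**, given its transport system: a Hägg word `s`
and a bijection `Φ : barlowStacking 1 √(2/3) s → S` with `dist p q = 1 ↔ Φ p, Φ q` bonded.  (The growth
descent of `barlowChart_of_stubs`, with the cubic growth of clean sets.) [folklore] -/
theorem barlowChart_of_clean_transport {S : Set (EuclideanSpace ℝ (Fin 3))}
    (hrad : ∀ y ∈ S, ∀ w ∈ S, w ≠ y → 2744 / 2550 ≤ dist y w ∧ (dist y w ≤ 28 / 25 ∨ 3528 / 2550 ≤ dist y w))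
    (hdir : ∀ x ∈ S, ∀ d : EuclideanSpace ℝ (Fin 3), ∃ y ∈ S, y ≠ x ∧ dist x y ≤ 28 / 25 ∧
      139 / 250 * ‖d‖ ≤ inner ℝ (y - x) d)
    (hT : TransportSystem S) : BarlowChart S := by
  obtain ⟨s, hs, Ψ, hcov⟩ := stub_developCovering S hT
  obtain ⟨hmaps, hsurj, hstar, hlink⟩ := hcov
  -- Step 1: `Ψ` is injective on the model (the growth descent).
  have hinj : Set.InjOn Ψ (barlowStacking 1 (Real.sqrt (2 / 3)) s) := by
    intro p hp p' hp' hpp'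
    by_contra hne'
    obtain ⟨σ, ⟨hbij, hcontact⟩, hdeck, -, hfree⟩ :=
      stub_deckTransitive S s Ψ hs ⟨hmaps, hsurj, hstar, hlink⟩ p hp p' hp' hpp' hne'
    have hd1 : ∀ q ∈ barlowStacking 1 (Real.sqrt (2 / 3)) s, dist q (σ q) ≠ 1 := by
      intro q hq h1
      have hσq : σ q ∈ contacts s q := ⟨hbij.mapsTo hq, h1⟩
      have hb : Ψ (σ q) ∈ bondNbrs S (Ψ q) := (hstar q hq).mapsTo hσq
      have hpos : 0 < dist (Ψ q) (Ψ (σ q)) := hb.2.1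
      rw [hdeck q hq, dist_self] at hpos
      exact lt_irrefl _ hpos
    have hd2 : ∀ q ∈ barlowStacking 1 (Real.sqrt (2 / 3)) s, ∀ m ∈ barlowStacking 1 (Real.sqrt (2 / 3)) s,
        dist q m = 1 → dist m (σ q) ≠ 1 := by
      intro q hq m hm hqm h2
      have hq' : q ∈ contacts s m := ⟨hq, by rw [dist_comm]; exact hqm⟩
      have hσq : σ q ∈ contacts s m := ⟨hbij.mapsTo hq, h2⟩
      exact hfree q hq ((hstar m hm).injOn hσq hq' (hdeck q hq))
    obtain ⟨τ, hτ, hper, n₀, hiter⟩ := stub_powerTranslation s σ hs ⟨hbij, hcontact⟩ hfree hd1 hd2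
    have hiterB : ∀ k : ℕ, ∀ q ∈ barlowStacking 1 (Real.sqrt (2 / 3)) s,
        σ^[k] q ∈ barlowStacking 1 (Real.sqrt (2 / 3)) s ∧ Ψ (σ^[k] q) = Ψ q := by
      intro k
      induction k with
      | zero => intro q hq; exact ⟨hq, rfl⟩
      | succ k ih =>
        intro q hq
        obtain ⟨hkq, hΨk⟩ := ih q hq
        refine ⟨?_, ?_⟩
        · rw [Function.iterate_succ_apply']
          exact hbij.mapsTo hkq
        · rw [Function.iterate_succ_apply', hdeck _ hkq, hΨk]
    have hΨτ : ∀ q ∈ barlowStacking 1 (Real.sqrt (2 / 3)) s, Ψ (q + τ) = Ψ q := by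
      intro q hq
      rw [← hiter q hq]
      exact (hiterB n₀ q hq).2
    have hstarsurj : ∀ p ∈ barlowStacking 1 (Real.sqrt (2 / 3)) s, bondNbrs S (Ψ p) ⊆ Ψ '' contacts s p :=
      fun p hp => (hstar p hp).surjOn
    obtain ⟨K, hK⟩ := stub_quotientGrowth S s Ψ τ hs hstarsurj hτ hper hΨτ p hp
    obtain ⟨n, hn⟩ := exists_nat_gt (max 12 (8788 * K + 8788))
    have h12 : (12 : ℝ) < n := lt_of_le_of_lt (le_max_left _ _) hn
    have hn12 : 12 ≤ n := by exact_mod_cast h12.le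
    have hKn : 8788 * K + 8788 < (n : ℝ) := lt_of_le_of_lt (le_max_right _ _) hn
    have hlow := clean_cubicGrowth hrad hdir (hmaps hp) hn12
    have hup := hK n
    have hle : ((n : ℝ) / 13) ^ 3 ≤ K * ((n : ℝ) + 1) ^ 2 := hlow.trans hup
    set N : ℝ := (n : ℝ) with hN
    have hN0 : (0 : ℝ) ≤ N := by positivity
    rcases le_or_gt K 0 with hK0 | hK0
    · have h1 : K * (N + 1) ^ 2 ≤ 0 := mul_nonpos_of_nonpos_of_nonneg hK0 (sq_nonneg _)
      have h2 : (0 : ℝ) < (N / 13) ^ 3 := by positivity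
      linarith
    · have h1 : K * (N + 1) ^ 2 ≤ (N / 8788 - 1) * (N + 1) ^ 2 :=
        mul_le_mul_of_nonneg_right (by linarith) (sq_nonneg _)
      have h2 : (N / 8788 - 1) * (N + 1) ^ 2 < (N / 13) ^ 3 := by
        nlinarith [sq_nonneg N, hN0]
      linarith
  -- Step 2: bijection and bond-faithfulness.
  refine ⟨s, hs, Ψ, ⟨hmaps, hinj, hsurj⟩, fun p hp q hq => ⟨fun hpq => ?_, fun hb => ?_⟩⟩
  · have hq' : q ∈ contacts s p := ⟨hq, hpq⟩
    exact ((hstar p hp).mapsTo hq').2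
  · have hy : Ψ q ∈ bondNbrs S (Ψ p) := ⟨hmaps hq, hb⟩
    obtain ⟨q', hq', hqq'⟩ := (hstar p hp).surjOn hy
    have hqeq : q' = q := hinj hq'.1 hq hqq'
    rw [← hqeq]
    exact hq'.2

/-- **Bond chart of a clean torn-free set at scale `56/51`.** [folklore] -/
theorem barlowChart_of_clean {S : Set (EuclideanSpace ℝ (Fin 3))} (hne : S.Nonempty)
    (hclean : ∀ y ∈ S, ({w ∈ S | w ≠ y ∧ dist y w ≤ 56 / 51 * (1 + 1 / 50)}.ncard = 12 ∧
        ∀ w ∈ S, w ≠ y → 56 / 51 * (1 - 1 / 50) ≤ dist y w ∧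
          (dist y w ≤ 56 / 51 * (1 + 1 / 50) ∨ 56 / 51 * (63 / 50) ≤ dist y w)) ∧
      ∃ T : Finset (EuclideanSpace ℝ (Fin 3)), (↑T : Set (EuclideanSpace ℝ (Fin 3))) =
          (fun w => (56 / 51 : ℝ)⁻¹ • (w - y)) '' {w ∈ S | w ≠ y ∧ dist y w ≤ 56 / 51 * (1 + 1 / 50)} ∧
        (ShellCloseTo (1 / 5) T fccKissingPattern ∨ ShellCloseTo (1 / 5) T hcpKissingPattern))
    (htorn : ∀ y ∈ S, ∀ v ∈ S, v ≠ y → dist y v ≤ 56 / 51 * (1 + 1 / 50) →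
      4 ≤ {w ∈ S | w ≠ y ∧ w ≠ v ∧ dist y w ≤ 56 / 51 * (1 + 1 / 50) ∧ dist v w ≤ 56 / 51 * (1 + 1 / 50)}.ncard) :
    BarlowChart S := by
  have hrad : ∀ y ∈ S, ∀ w ∈ S, w ≠ y → 2744 / 2550 ≤ dist y w ∧ (dist y w ≤ 28 / 25 ∨ 3528 / 2550 ≤ dist y w) := by
    intro y hy w hw hne'
    have h := (hclean y hy).1.2 w hw hne'
    norm_num at h
    refine ⟨by linarith [h.1], ?_⟩
    rcases h.2 with h2 | h2
    · left; linarith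
    · right; linarith
  have hdir := clean_direction hclean htorn
  obtain ⟨Pc, nb, hch⟩ := clean_charts hclean htorn
  have hT : TransportSystem S :=
    Clean.transportSystem_of_connected hne hch (clean_connected hrad hdir)
  exact barlowChart_of_clean_transport hrad hdir hT

/-! ## Scaling -/

section Scaling

variable {Z : Set (EuclideanSpace ℝ (Fin 3))} {a c : ℝ}

/-- Distances scale. [folklore] -/
theorem dist_smul_smul (hc : 0 < c) (p q : EuclideanSpace ℝ (Fin 3)) : dist (c • p) (c • q) = c * dist p q := by
  rw [dist_smul₀, Real.norm_of_nonneg hc.le]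

/-- The bond set of a scaled site is the scaled bond set. [folklore] -/
theorem bondSet_smul (hc : 0 < c) {y : EuclideanSpace ℝ (Fin 3)} (r : ℝ) :
    {w ∈ (fun p => c • p) '' Z | w ≠ c • y ∧ dist (c • y) w ≤ c * r} =
      (fun p => c • p) '' {w ∈ Z | w ≠ y ∧ dist y w ≤ r} := by
  ext w
  simp only [Set.mem_setOf_eq, Set.mem_image]
  constructor
  · rintro ⟨⟨p, hp, rfl⟩, hne, hd⟩
    refine ⟨p, ⟨hp, fun h => hne (by rw [h]), ?_⟩, rfl⟩
    rw [dist_smul_smul hc] at hd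
    exact le_of_mul_le_mul_left hd hc
  · rintro ⟨p, ⟨hp, hne, hd⟩, rfl⟩
    refine ⟨⟨p, hp, rfl⟩, fun h => hne (smul_right_injective _ hc.ne' h), ?_⟩
    rw [dist_smul_smul hc]
    exact mul_le_mul_of_nonneg_left hd hc.le

/-- **Cleanness is scale-covariant.** [folklore] -/
theorem clean_smul (hc : 0 < c)
    (hclean : ∀ y ∈ Z, ({w ∈ Z | w ≠ y ∧ dist y w ≤ a * (1 + 1 / 50)}.ncard = 12 ∧
        ∀ w ∈ Z, w ≠ y → a * (1 - 1 / 50) ≤ dist y w ∧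
          (dist y w ≤ a * (1 + 1 / 50) ∨ a * (63 / 50) ≤ dist y w)) ∧
      ∃ T : Finset (EuclideanSpace ℝ (Fin 3)), (↑T : Set (EuclideanSpace ℝ (Fin 3))) =
          (fun w => a⁻¹ • (w - y)) '' {w ∈ Z | w ≠ y ∧ dist y w ≤ a * (1 + 1 / 50)} ∧
        (ShellCloseTo (1 / 5) T fccKissingPattern ∨ ShellCloseTo (1 / 5) T hcpKissingPattern)) :
    ∀ y ∈ (fun p => c • p) '' Z, ({w ∈ (fun p => c • p) '' Z | w ≠ y ∧ dist y w ≤ c * a * (1 + 1 / 50)}.ncard = 12 ∧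
        ∀ w ∈ (fun p => c • p) '' Z, w ≠ y → c * a * (1 - 1 / 50) ≤ dist y w ∧
          (dist y w ≤ c * a * (1 + 1 / 50) ∨ c * a * (63 / 50) ≤ dist y w)) ∧
      ∃ T : Finset (EuclideanSpace ℝ (Fin 3)), (↑T : Set (EuclideanSpace ℝ (Fin 3))) =
          (fun w => (c * a)⁻¹ • (w - y)) '' {w ∈ (fun p => c • p) '' Z | w ≠ y ∧ dist y w ≤ c * a * (1 + 1 / 50)} ∧
        (ShellCloseTo (1 / 5) T fccKissingPattern ∨ ShellCloseTo (1 / 5) T hcpKissingPattern) := by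
  rintro _ ⟨y, hy, rfl⟩
  obtain ⟨⟨hn, hrad⟩, T, hT, hclose⟩ := hclean y hy
  have hinj : Set.InjOn (fun p : EuclideanSpace ℝ (Fin 3) => c • p) {w ∈ Z | w ≠ y ∧ dist y w ≤ a * (1 + 1 / 50)} :=
    (smul_right_injective _ hc.ne').injOn
  have hset := bondSet_smul (Z := Z) hc (y := y) (a * (1 + 1 / 50))
  rw [← mul_assoc] at hset
  refine ⟨⟨?_, ?_⟩, T, ?_, hclose⟩
  · rw [hset, hinj.ncard_image, hn]
  · rintro _ ⟨w, hw, rfl⟩ hne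
    have hne' : w ≠ y := fun h => hne (by rw [h])
    have h := hrad w hw hne'
    rw [dist_smul_smul hc]
    refine ⟨by nlinarith [h.1], ?_⟩
    rcases h.2 with h2 | h2
    · left; nlinarith
    · right; nlinarith
  · rw [hset, Set.image_image, hT]
    refine Set.image_congr fun w _ => ?_
    show a⁻¹ • (w - y) = (c * a)⁻¹ • (c • w - c • y)
    rw [← smul_sub, smul_smul]
    congr 1
    field_simp

/-- **Torn-freeness is scale-covariant.** [folklore] -/
theorem torn_smul (hc : 0 < c)
    (htorn : ∀ y ∈ Z, ∀ v ∈ Z, v ≠ y → dist y v ≤ a * (1 + 1 / 50) →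
      4 ≤ {w ∈ Z | w ≠ y ∧ w ≠ v ∧ dist y w ≤ a * (1 + 1 / 50) ∧ dist v w ≤ a * (1 + 1 / 50)}.ncard) :
    ∀ y ∈ (fun p => c • p) '' Z, ∀ v ∈ (fun p => c • p) '' Z, v ≠ y → dist y v ≤ c * a * (1 + 1 / 50) →
      4 ≤ {w ∈ (fun p => c • p) '' Z | w ≠ y ∧ w ≠ v ∧ dist y w ≤ c * a * (1 + 1 / 50) ∧
        dist v w ≤ c * a * (1 + 1 / 50)}.ncard := by
  rintro _ ⟨y, hy, rfl⟩ _ ⟨v, hv, rfl⟩ hne hd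
  have hne' : v ≠ y := fun h => hne (by rw [h])
  rw [dist_smul_smul hc, mul_assoc] at hd
  have hd' : dist y v ≤ a * (1 + 1 / 50) := le_of_mul_le_mul_left hd hc
  have h4 := htorn y hy v hv hne' hd'
  have hset : {w ∈ (fun p => c • p) '' Z | w ≠ c • y ∧ w ≠ c • v ∧ dist (c • y) w ≤ c * a * (1 + 1 / 50) ∧
      dist (c • v) w ≤ c * a * (1 + 1 / 50)} =
      (fun p => c • p) '' {w ∈ Z | w ≠ y ∧ w ≠ v ∧ dist y w ≤ a * (1 + 1 / 50) ∧ dist v w ≤ a * (1 + 1 / 50)} := by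
    ext w
    simp only [Set.mem_setOf_eq, Set.mem_image]
    constructor
    · rintro ⟨⟨p, hp, rfl⟩, h1, h2, h3, h4⟩
      refine ⟨p, ⟨hp, fun h => h1 (by rw [h]), fun h => h2 (by rw [h]), ?_, ?_⟩, rfl⟩
      · rw [dist_smul_smul hc, mul_assoc] at h3; exact le_of_mul_le_mul_left h3 hc
      · rw [dist_smul_smul hc, mul_assoc] at h4; exact le_of_mul_le_mul_left h4 hc
    · rintro ⟨p, ⟨hp, h1, h2, h3, h4⟩, rfl⟩
      refine ⟨⟨p, hp, rfl⟩, fun h => h1 (smul_right_injective _ hc.ne' h),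
        fun h => h2 (smul_right_injective _ hc.ne' h), ?_, ?_⟩
      · rw [dist_smul_smul hc, mul_assoc]; exact mul_le_mul_of_nonneg_left h3 hc.le
      · rw [dist_smul_smul hc, mul_assoc]; exact mul_le_mul_of_nonneg_left h4 hc.le
  rw [hset, (smul_right_injective _ hc.ne').injOn.ncard_image]
  exact h4

end Scaling

/-! ## The stub -/

/-- **Stub K1 (clean chart; geometry).** A non-empty set in which every site is clean at scale `a` and
every bond has `≥ 4` common neighbours is, combinatorially, the octet truss of an ideal unit Barlow
stacking: there are a Hägg word `s` and a bijection `Φ : barlowStacking 1 √(2/3) s → Z` carrying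
"distance exactly `1`" to "bonded" (`dist ≤ 1.02 a`). [folklore] -/
theorem stub_cleanChart : ∀ (Z : Set (EuclideanSpace ℝ (Fin 3))) (a : ℝ), 0 < a → Z.Nonempty →
    (∀ y ∈ Z, ({w ∈ Z | w ≠ y ∧ dist y w ≤ a * (1 + 1 / 50)}.ncard = 12 ∧
        ∀ w ∈ Z, w ≠ y → a * (1 - 1 / 50) ≤ dist y w ∧
          (dist y w ≤ a * (1 + 1 / 50) ∨ a * (63 / 50) ≤ dist y w)) ∧
      ∃ T : Finset (EuclideanSpace ℝ (Fin 3)), (↑T : Set (EuclideanSpace ℝ (Fin 3))) =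
          (fun w => a⁻¹ • (w - y)) '' {w ∈ Z | w ≠ y ∧ dist y w ≤ a * (1 + 1 / 50)} ∧
        (ShellCloseTo (1 / 5) T fccKissingPattern ∨ ShellCloseTo (1 / 5) T hcpKissingPattern)) →
    (∀ y ∈ Z, ∀ v ∈ Z, v ≠ y → dist y v ≤ a * (1 + 1 / 50) →
      4 ≤ {w ∈ Z | w ≠ y ∧ w ≠ v ∧ dist y w ≤ a * (1 + 1 / 50) ∧ dist v w ≤ a * (1 + 1 / 50)}.ncard) →
    ∃ (s : ℤ → ℤ) (Φ : EuclideanSpace ℝ (Fin 3) → EuclideanSpace ℝ (Fin 3)), IsHaggSeq s ∧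
      Set.BijOn Φ (barlowStacking 1 (Real.sqrt (2 / 3)) s) Z ∧
      ∀ p ∈ barlowStacking 1 (Real.sqrt (2 / 3)) s, ∀ q ∈ barlowStacking 1 (Real.sqrt (2 / 3)) s, p ≠ q →
        (dist p q = 1 ↔ dist (Φ p) (Φ q) ≤ a * (1 + 1 / 50)) := by
  intro Z a ha hne hclean htorn
  -- rescale to bond length `56/51`
  set c : ℝ := 56 / 51 * a⁻¹ with hc
  have hc0 : 0 < c := by positivity
  have hca : c * a = 56 / 51 := by rw [hc, mul_assoc, inv_mul_cancel₀ ha.ne', mul_one]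
  set S : Set (EuclideanSpace ℝ (Fin 3)) := (fun p => c • p) '' Z with hS
  have hneS : S.Nonempty := hne.image _
  have hcleanS := clean_smul (Z := Z) (a := a) hc0 hclean
  have htornS := torn_smul (Z := Z) (a := a) hc0 htorn
  rw [hca] at hcleanS htornS
  obtain ⟨s, hs, Ψ, hbij, hiff⟩ := barlowChart_of_clean hneS hcleanS htornS
  -- scale back
  have hback : Set.BijOn (fun p : EuclideanSpace ℝ (Fin 3) => c⁻¹ • p) S Z := by
    refine ⟨?_, (smul_right_injective _ (inv_ne_zero hc0.ne')).injOn, ?_⟩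
    · rintro _ ⟨p, hp, rfl⟩
      show c⁻¹ • c • p ∈ Z
      rw [smul_smul, inv_mul_cancel₀ hc0.ne', one_smul]; exact hp
    · intro p hp
      exact ⟨c • p, ⟨p, hp, rfl⟩, by show c⁻¹ • c • p = p; rw [smul_smul, inv_mul_cancel₀ hc0.ne', one_smul]⟩
  refine ⟨s, fun p => c⁻¹ • Ψ p, hs, hback.comp hbij, fun p hp q hq hpq => ?_⟩
  rw [hiff p hp q hq]
  show _ ↔ dist (c⁻¹ • Ψ p) (c⁻¹ • Ψ q) ≤ a * (1 + 1 / 50)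
  rw [dist_smul_smul (inv_pos.2 hc0)]
  have hpos : 0 < dist (Ψ p) (Ψ q) := dist_pos.2 fun h => hpq (hbij.injOn hp hq h)
  have hc' : c⁻¹ = 51 / 56 * a := by rw [hc, mul_inv, inv_inv]; norm_num
  rw [hc']
  constructor
  · rintro ⟨-, h⟩; nlinarith
  · intro h; exact ⟨hpos, by nlinarith⟩

end Summit.AtomisticToContinuum.Crystallization.Theorems.CleanHull

end
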